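import Summits.CriticalPhenomena.CardyFormulaZ2.Theorems.CardyMagicRigidityPinchResamplingDefsV3
import HarnessLib

/-!
# Stub S5 `stub_fiveArmUpperT` of line `pinch-resampling` v3 (crux stmt-CriticalPhenomena-4835): audit and reduction

Crux `Summit.CriticalPhenomena.CardyFormulaZ2.Theses.CardyMagicRigidity.NestingRigidity`, stub S5
`stub_fiveArmUpperT : FiveArmUpperT` — the two-radii five-arm UPPER bound
`P_{1/2}(armEvent (T,F,T,F,F) m n) ≤ C (m/n)²` for critical site percolation on `𝕋`
(`Theorems/CardyMagicRigidityPinchResamplingDefsV3.lean`).  This file is sorry-free and proves NO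
published theorem; it records (A) the audit of the statement and (B) the bookkeeping that reduces it
to the two printed inputs of P. Nolin, *Near-critical percolation in two dimensions*, EJP 13 (2008):
the single-radius five-arm estimate `α₅ = 2` (§5.2, Thm. 24, five-arm item [arXiv 0711.4948:
Thm. 23]) and quasi-multiplicativity (Prop. 17 [arXiv: Prop. 16]), the LOWER bound being the tree's
theorem `fiveArm_lowerBound` (`FiveArmLowerBound.lean`).

* `armEvent_zero_eq_empty` — the degenerate inner radius: `armEvent κ 0 n = ∅` as soon as there are
  at least two arms (`∂Λ₀ = {0}` and the arms are vertex-disjoint).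
* `armUpperBound_iff_forall` — NORMAL FORM of two-radii upper bounds `P_{1/2}(armEvent κ m n) ≤
  C (m/n)²`: the threshold `m₀ ≤ m` is cosmetic (monotonicity in the inner radius,
  `armEvent_mono_left`, absorbs `m < m₀` into the constant; `m = 0` is the empty event), so the
  `∃ C, ∃ m₀` form is equivalent to `∃ C, ∀ m ≤ n`.  `fiveArmUpperT_iff_forall` is the instance
  for `FiveArmUpperT` (the registered anchor of this file): the stub's quantifier structure is right.
* `fiveArm_lowerBound_half` — the tree's lower bound at `t = 1/2`, unpacked.
* `fiveArmUpperT_of_pointBound_of_quasiMult` — **the reduction**: `FiveArmUpperT` follows from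
  (i) a single-radius bound `P_{1/2}(armEvent (T,F,T,F,F) m n) ≤ C(m) / n²` at every fixed inner
  radius and (ii) the gluing half of quasi-multiplicativity
  `c · P(n₁,n₂) P(n₂,n₃) ≤ P(n₁,n₃)` (`m₀ ≤ n₁ < n₂ < n₃`), by
  `P(m,n) ≤ P(M,n) / (c P(M,m)) ≤ (C(M)/n²) / (c c' M²/m²)` with the lower bound `c' (M/m)² ≤ P(M,m)`.
  Both (i) and (ii) are hypotheses here (explicit `Prop` terms); the companion file
  `CardyMagicRigidityNestingRigidityFiveArmUpperFacts.lean` records them as the named facts they are.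

References: P. Nolin, EJP 13 (2008) 1562–1623, §4.5 Prop. 17, §5.2 Thm. 24 [arXiv 0711.4948:
Prop. 16, Thm. 23]; H. Kesten, V. Sidoravicius, Y. Zhang, EJP 3 (1998), paper 10, Lemma 5;
W. Werner, PCMI 16 (2009), Lecture 6 §3 and first exercise sheet ("Five-arm exponent").
-/

noncomputable section

namespace Summit.CriticalPhenomena.CardyFormulaZ2.Cruxes.NestingRigidity.PinchResampling

open Summit.CriticalPhenomena.CardyFormulaZ2.Theses.CardyMagicRigidity
open MeasureTheory Literature.Probability.Percolation Literature.Probability.LatticeModels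

/-! ## (A) Audit: degenerate radii and the normal form -/

/-- **Degenerate inner radius.**  With at least two arms the arm event from `∂Λ₀ = {0}` is empty:
two vertex-disjoint arms cannot both start at the origin.  In particular
`armEvent ![T,F,T,F,F] 0 n = ∅`, so the case `m = 0` of `FiveArmUpperT` is vacuous. -/
theorem armEvent_zero_eq_empty {k : ℕ} (κ : Fin k → Bool) (hk : 2 ≤ k) (n : ℕ) :
    armEvent κ 0 n = ∅ := by
  classical
  ext ω
  simp only [Set.mem_empty_iff_false, iff_false]
  rintro ⟨x, y, w, hw, hdisj⟩
  set i : Fin k := ⟨0, by omega⟩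
  set j : Fin k := ⟨1, by omega⟩
  have hij : i ≠ j := fun h => by
    have := congrArg Fin.val h
    simp [i, j] at this
  have hxi : x i = 0 := eq_zero_of_triNorm_eq_zero (mem_triSphere_iff.1 (hw i).1)
  have hxj : x j = 0 := eq_zero_of_triNorm_eq_zero (mem_triSphere_iff.1 (hw j).1)
  have h1 : x i ∈ (w i).support := (w i).start_mem_support
  have h2 : x i ∈ (w j).support := by
    rw [hxi, ← hxj]
    exact (w j).start_mem_support
  exact Finset.disjoint_left.1 (hdisj hij) (List.mem_toFinset.2 h1) (List.mem_toFinset.2 h2)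

/-- The arm probability at `p = 1/2` is at most one (it is a probability). -/
theorem real_armEvent_le_one {k : ℕ} (κ : Fin k → Bool) (m n : ℕ) :
    (triSitePercolation half).real (armEvent κ m n) ≤ 1 :=
  polyArmProb_le_one κ m n

/-- Monotonicity in the inner radius, in probability: for `m ≤ m' ≤ n`,
`P_{1/2}(armEvent κ m n) ≤ P_{1/2}(armEvent κ m' n)` (`armEvent_mono_left`). -/
theorem real_armEvent_inner_mono {k : ℕ} (κ : Fin k → Bool) {m m' n : ℕ} (hm : m ≤ m')
    (hn : m' ≤ n) :
    (triSitePercolation half).real (armEvent κ m n) ≤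
      (triSitePercolation half).real (armEvent κ m' n) :=
  measureReal_mono (armEvent_mono_left κ hm hn) (measure_ne_top _ _)

/-- **Normal form of two-radii upper bounds with exponent `2`.**  For at least two arms, an
eventual bound `P_{1/2}(armEvent κ m n) ≤ C (m/n)²` (`m₀ ≤ m ≤ n`) is equivalent to the same
bound for ALL `m ≤ n` with another constant: below the threshold, `P(m,n) ≤ P(M,n) ≤ C (M/n)² ≤
C M² (m/n)²` for `1 ≤ m` (`armEvent_mono_left`), `P ≤ 1 ≤ C M² (m/n)²` when `n < M`, and `m = 0`
is the empty event (`armEvent_zero_eq_empty`); here `M = max m₀ 1` and the new constant is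
`max C 1 · M²`. -/
theorem armUpperBound_iff_forall {k : ℕ} (κ : Fin k → Bool) (hk : 2 ≤ k) :
    (∃ C : ℝ, ∃ m₀ : ℕ, ∀ m n : ℕ, m₀ ≤ m → m ≤ n →
        (triSitePercolation half).real (armEvent κ m n) ≤ C * ((m : ℝ) / n) ^ 2) ↔
      ∃ C : ℝ, ∀ m n : ℕ, m ≤ n →
        (triSitePercolation half).real (armEvent κ m n) ≤ C * ((m : ℝ) / n) ^ 2 := by
  refine ⟨fun ⟨C, m₀, h⟩ => ?_, fun ⟨C, h⟩ => ⟨C, 0, fun m n _ hmn => h m n hmn⟩⟩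
  set M : ℕ := max m₀ 1 with hM
  have hM1 : 1 ≤ M := le_max_right _ _
  have hM0 : m₀ ≤ M := le_max_left _ _
  have hMpos : (0 : ℝ) < M := by exact_mod_cast hM1
  refine ⟨max C 1 * (M : ℝ) ^ 2, fun m n hmn => ?_⟩
  have hC1 : (1 : ℝ) ≤ max C 1 := le_max_right _ _
  have hC0 : (0 : ℝ) ≤ max C 1 := zero_le_one.trans hC1
  rcases Nat.eq_zero_or_pos m with hm0 | hm1
  · -- `m = 0`: the empty event
    subst hm0
    rw [armEvent_zero_eq_empty κ hk n, measureReal_empty]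
    simp
  have hn1 : (1 : ℝ) ≤ n := by exact_mod_cast Nat.lt_of_lt_of_le hm1 hmn
  have hn0 : (0 : ℝ) < n := by linarith
  have hm1' : (1 : ℝ) ≤ m := by exact_mod_cast hm1
  -- the ratio `m/n` dominates `1/n`
  have hratio : (1 : ℝ) / n ≤ (m : ℝ) / n := div_le_div_of_nonneg_right hm1' hn0.le
  have hratio0 : (0 : ℝ) ≤ (m : ℝ) / n := by positivity
  by_cases hnM : n < M
  · -- `n < M`: the bound is at least `1`
    have hq : (1 : ℝ) / M ≤ (m : ℝ) / n := by
      have hnM' : (n : ℝ) ≤ M := by exact_mod_cast hnM.le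
      calc (1 : ℝ) / M ≤ 1 / n := one_div_le_one_div_of_le hn0 hnM'
        _ ≤ (m : ℝ) / n := hratio
    have hq2 : ((1 : ℝ) / M) ^ 2 ≤ ((m : ℝ) / n) ^ 2 :=
      pow_le_pow_left₀ (by positivity) hq 2
    calc (triSitePercolation half).real (armEvent κ m n) ≤ 1 := real_armEvent_le_one κ m n
      _ = 1 * ((M : ℝ) ^ 2 * ((1 : ℝ) / M) ^ 2) := by field_simp
      _ ≤ max C 1 * ((M : ℝ) ^ 2 * ((m : ℝ) / n) ^ 2) := by gcongr
      _ = max C 1 * (M : ℝ) ^ 2 * ((m : ℝ) / n) ^ 2 := by ring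
  rw [not_lt] at hnM
  by_cases hmM : M ≤ m
  · -- above the threshold: the hypothesis, with a larger constant
    calc (triSitePercolation half).real (armEvent κ m n) ≤ C * ((m : ℝ) / n) ^ 2 :=
          h m n (hM0.trans hmM) hmn
      _ ≤ max C 1 * ((m : ℝ) / n) ^ 2 := by gcongr; exact le_max_left _ _
      _ = max C 1 * 1 * ((m : ℝ) / n) ^ 2 := by ring
      _ ≤ max C 1 * (M : ℝ) ^ 2 * ((m : ℝ) / n) ^ 2 := by
          gcongr
          exact_mod_cast Nat.one_le_pow 2 M hM1
  · -- `1 ≤ m < M ≤ n`: move the inner radius up to `M`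
    rw [not_le] at hmM
    calc (triSitePercolation half).real (armEvent κ m n)
        ≤ (triSitePercolation half).real (armEvent κ M n) := real_armEvent_inner_mono κ hmM.le hnM
      _ ≤ C * ((M : ℝ) / n) ^ 2 := h M n hM0 hnM
      _ ≤ max C 1 * ((M : ℝ) / n) ^ 2 := by gcongr; exact le_max_left _ _
      _ = max C 1 * (M : ℝ) ^ 2 * ((1 : ℝ) / n) ^ 2 := by ring
      _ ≤ max C 1 * (M : ℝ) ^ 2 * ((m : ℝ) / n) ^ 2 := by gcongr

/-- **Audit of the registered statement (anchor of this file).**  `FiveArmUpperT` is equivalent to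
its threshold-free normal form: `∃ C, ∀ m ≤ n, P_{1/2}(armEvent (T,F,T,F,F) m n) ≤ C (m/n)²`.  So
neither the degenerate radius `m = 0` (empty event) nor `m = n` (forces `C ≥ 1`) nor the order of
the quantifiers `∃ C ∃ m₀` is an issue: the statement is the classical two-radii five-arm upper
bound and nothing more. -/
theorem fiveArmUpperT_iff_forall :
    FiveArmUpperT ↔ ∃ C : ℝ, ∀ m n : ℕ, m ≤ n →
      (triSitePercolation half).real (armEvent ![true, false, true, false, false] m n) ≤
        C * ((m : ℝ) / n) ^ 2 :=
  armUpperBound_iff_forall _ (by norm_num)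

/-! ## (B) The reduction to the single-radius estimate and quasi-multiplicativity -/

/-- **The tree's five-arm LOWER bound at `p = 1/2`**, unpacked from `fiveArm_lowerBound`
(Werner 2009, Lecture 6 §3; Nolin 2008, Thm. 24 (ii)): there are `r₁` and `c > 0` with
`c (m/n)² ≤ P_{1/2}(armEvent (T,F,T,F,F) m n)` for `r₁ ≤ m ≤ n` (at `t = 1/2` the restriction
`n ≤ L(t, ε)` is void). -/
theorem fiveArm_lowerBound_half :
    ∃ r₁ : ℕ, ∃ c > (0 : ℝ), ∀ m n : ℕ, r₁ ≤ m → m ≤ n →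
      c * ((m : ℝ) / n) ^ 2 ≤
        (triSitePercolation half).real (armEvent ![true, false, true, false, false] m n) := by
  obtain ⟨ε₁, hε₁, H⟩ := fiveArm_lowerBound
  obtain ⟨r₁, δ, hδ, c, hc, h⟩ := H (half_pos hε₁) (half_lt_self hε₁)
  refine ⟨r₁, c, hc, fun m n hm hmn => h half ?_ ?_ m n hm hmn ?_⟩
  · rw [coe_half]
  · rw [coe_half]; linarith
  · intro hlt; rw [coe_half] at hlt; exact absurd hlt (lt_irrefl _)

/-- **`FiveArmUpperT` from the single-radius five-arm estimate and quasi-multiplicativity**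
(the bookkeeping "two radii by quasi-multiplicativity": Nolin 2008, §4.5, Prop. 17 and §5.2,
Thm. 24 [arXiv 0711.4948: Prop. 16, Thm. 23]).  Hypotheses, both for the colour sequence
`(T,F,T,F,F)` at `p = 1/2`: `hpt` — at every fixed inner radius `m ≥ 1` there is `C(m)` with
`P_{1/2}(armEvent κ m n) ≤ C(m)/n²` for `n ≥ m`; `hqm` — the gluing half of quasi-multiplicativity,
`c · P(n₁,n₂) · P(n₂,n₃) ≤ P(n₁,n₃)` for `m₀ ≤ n₁ < n₂ < n₃`.  Proof: with `M = max(m₀, r₁, 1)`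
(`r₁` from `fiveArm_lowerBound_half`) and `M < m < n`,
`c · c' (M/m)² · P(m,n) ≤ c · P(M,m) P(m,n) ≤ P(M,n) ≤ C(M)/n²`, whence
`P(m,n) ≤ (C(M)/(c c' M²)) (m/n)²`; `m = n` costs a constant `≥ 1`. -/
theorem fiveArmUpperT_of_pointBound_of_quasiMult
    (hpt : ∀ m : ℕ, 1 ≤ m → ∃ C : ℝ, ∀ n : ℕ, m ≤ n →
      (triSitePercolation half).real (armEvent ![true, false, true, false, false] m n) ≤
        C / (n : ℝ) ^ 2)
    (hqm : ∃ c > (0 : ℝ), ∃ m₀ : ℕ, ∀ n₁ n₂ n₃ : ℕ, m₀ ≤ n₁ → n₁ < n₂ → n₂ < n₃ →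
      c * ((triSitePercolation half).real (armEvent ![true, false, true, false, false] n₁ n₂) *
          (triSitePercolation half).real (armEvent ![true, false, true, false, false] n₂ n₃)) ≤
        (triSitePercolation half).real (armEvent ![true, false, true, false, false] n₁ n₃)) :
    FiveArmUpperT := by
  obtain ⟨c, hc, m₀, hq⟩ := hqm
  obtain ⟨r₁, c', hc', hlb⟩ := fiveArm_lowerBound_half
  set M : ℕ := max (max m₀ r₁) 1 with hM
  have hM0 : m₀ ≤ M := (le_max_left _ _).trans (le_max_left _ _)
  have hMr : r₁ ≤ M := (le_max_right _ _).trans (le_max_left _ _)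
  have hM1 : 1 ≤ M := le_max_right _ _
  have hMpos : (0 : ℝ) < M := by exact_mod_cast hM1
  obtain ⟨CM, hCM⟩ := hpt M hM1
  set K : ℝ := max (CM / (c * c' * (M : ℝ) ^ 2)) 1 with hK
  refine ⟨K, M + 1, fun m n hm hmn => ?_⟩
  have hK1 : (1 : ℝ) ≤ K := le_max_right _ _
  have hm0 : (0 : ℝ) < m := by exact_mod_cast (by omega : 0 < m)
  have hn0 : (0 : ℝ) < n := by exact_mod_cast (by omega : 0 < n)
  rcases eq_or_lt_of_le hmn with heq | hlt
  · -- `m = n`: a probability is at most `1 ≤ K`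
    subst heq
    rw [div_self hm0.ne', one_pow, mul_one]
    exact (real_armEvent_le_one _ m m).trans hK1
  -- `M < m < n`: glue at the intermediate radius `m`
  set P : ℕ → ℕ → ℝ := fun a b =>
    (triSitePercolation half).real (armEvent ![true, false, true, false, false] a b) with hP
  have hglue : c * (P M m * P m n) ≤ P M n := hq M m n hM0 (by omega) hlt
  have hup : P M n ≤ CM / (n : ℝ) ^ 2 := hCM n (by omega)
  have hlow : c' * ((M : ℝ) / m) ^ 2 ≤ P M m := hlb M m hMr (by omega)
  have hPmn : 0 ≤ P m n := measureReal_nonneg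
  have hL : 0 < c' * ((M : ℝ) / m) ^ 2 := by positivity
  -- `c · c' (M/m)² · P(m,n) ≤ C(M)/n²`
  have hmain : P m n * (c * (c' * ((M : ℝ) / m) ^ 2)) ≤ CM / (n : ℝ) ^ 2 :=
    calc P m n * (c * (c' * ((M : ℝ) / m) ^ 2)) = c * (c' * ((M : ℝ) / m) ^ 2 * P m n) := by ring
      _ ≤ c * (P M m * P m n) := by gcongr
      _ ≤ P M n := hglue
      _ ≤ CM / (n : ℝ) ^ 2 := hup
  have hdiv : P m n ≤ CM / (n : ℝ) ^ 2 / (c * (c' * ((M : ℝ) / m) ^ 2)) :=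
    (le_div_iff₀ (by positivity)).2 hmain
  have hrew : CM / (n : ℝ) ^ 2 / (c * (c' * ((M : ℝ) / m) ^ 2)) =
      CM / (c * c' * (M : ℝ) ^ 2) * ((m : ℝ) / n) ^ 2 := by
    field_simp
  calc (triSitePercolation half).real (armEvent ![true, false, true, false, false] m n)
      = P m n := rfl
    _ ≤ CM / (c * c' * (M : ℝ) ^ 2) * ((m : ℝ) / n) ^ 2 := hrew ▸ hdiv
    _ ≤ K * ((m : ℝ) / n) ^ 2 := by gcongr; exact le_max_left _ _

end Summit.CriticalPhenomena.CardyFormulaZ2.Cruxes.NestingRigidity.PinchResampling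

end
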